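import Summits.BirchSwinnertonDyer.Rank1Residual.Additive.CensusQ6CoeffValuation
import Summits.BirchSwinnertonDyer.Rank1Residual.Additive.CensusX42BSDIMC
import HarnessLib

/-!
# Census relation X4-2 at the pair on a row whose linear coefficient has valuation `v₁`:
# `ord_p q + ord_p Reg_p(E, Dh) = 1 + v₁` — the kernel of the informational KURREG column
# `vReg_x42(v₁)` (cell `b2b-bsdres`, census cell `bsd-formula-census`, seat
# `b2b-bsdres-census-ctyper1` = conjecture-typer 1, gen 4; n1011 ROUTE-2 §II.12 / r2 INBOX
# 2026-08-21T08:22Z; sequel of `CensusX42BSD.lean` §1 (p255301) and `CensusQ6CoeffValuation.lean`)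

HONEST FRAMING (cell `b2b-bsdres`, run/shared/lean/b2b/bsd-rank1-residual/, verbatim in every
file): the goal of the cell is to DELETE the COMBINATION-SHAPED residual classes of the
Birch–Swinnerton-Dyer formula for ALL analytic-rank `≤ 1` elliptic curves over `ℚ` — "full BSD
formula for every rank `≤ 1` curve in class `C`" assembled STRICTLY from published theorems — so
that the rank-`≤ 1` remainder becomes exactly the CONSTRUCTION-SHAPED classes, which are TYPED
(missing-input `Prop`s), NOT attempted. This is not "finishing BSD". Census cell
(bsd-formula-census): research instrumentation; census output = EVIDENCE / conjecture items and
per-pair CERTIFICATE-EVIDENCE (instrumentation tier), never a Literature fact; labels / RESIDUAL-MAP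
marks UNCHANGED (O7 OPEN); nothing booked. THEOREMS ONLY (no definition, no named fact); the census
inputs are HYPOTHESES: the typed relation `CensusX42.RelationAt W p Dh` (CANDIDATE, `@[conjecture]`
def of `CensusX42LeadingTerm.lean`; X42-REPORT.md sha256
`e8592c9a2e1a59c13e754928288c9f6b1ce554f7ffb80b93db3c55aa7f5e9950`, LEADERBOARD rows 10–11
'claimed … until re-scored by a second seat') and the coefficient-valuation record
`CensusQ6.GordCoeffValAt W p 1 v₁` / `CensusQ6.MultCoeffValAt W p 1 v₁` (CERTIFICATE-EVIDENCE).

## What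

`CensusX42BSD.lean` §1 read the census identity on a CERTIFIED row (`‖ϖ·[T¹]B‖_p = 1`) as
`ord_p q + ord_p Reg_p(E,Dh) = 1` (`L'(E,1) = q·Ω_E·Reg_∞`). On the rows where the first stabilised
coefficient is NOT a unit (Route G's index `b ≥ 2` rows: n1011-r2's types TAM2+ / SHA3 / L2) the
census still records `v₁ := v_p(ϖ·[T¹]B)` (`CensusQ6.GordCoeffValAt W p 1 v₁`), and the SAME
bookkeeping gives, AT THE PAIR and GIVEN the candidate relation:
  `Reg_p(E,Dh) ≠ 0` and `ord_p q + ord_p Reg_p(E,Dh) = 1 + v₁`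
(§1 `padicValRat_add_valuation_eq_of_identity_of_valuation`; §2 pointwise for a (G)-ordinary resp.
multiplicative twist model; §3 from the record on the (G-ord, `e = 2`) rows / the (M) rows — the twist
model, newform and period ratio being kernel theorems `TypeGOrd.exists_goodOrd_pStar_twist_model`,
`PotMult.exists_mult_pStar_twist_model`, `exists_periodRatio_parity`; §4 with `#Ш_an = s`:
`ord_p Reg_p(E,Dh) = 1 + v₁ + 2·ord_p #T − ord_p s − ord_p ∏c` = r2's DERIVED informational column
`vReg_x42(v₁)` of `PREDICTIONS-KURREG.md` (EVIDENCE × EVIDENCE; never scored as K0/K1/K2)). The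
rank-one identity side (`ord_p #Ш + ord_p Reg_p + ord_p ∏c + ord_p ℓ_p = v₁ + 1 + 2·ord_p #T`) is
n1011-p01's `ClassX4Gord.schneider_and_padicVal_identity_rankOne_of_katoHalf_of_coeffCert_of_budget`
(p257300), NOT restated here. §5: the THREE-RECORD node on the (G-ord) big-image rows — Q6 record at
ANY `n₀` + `BudgetLeLambdaAt p W n₀` + (∀ (B)-datum, census relation) + the published facts ⟹
`BSD(E,p)` (`CensusX42BSDIMC.lean` §4a ∘ the interlock of `CensusQ6CoeffValuation.lean`; the (M)
twins over `CensusQ6.Mult[Odd]FirstUnitIndexAt` are `CensusX42BSDIMC.lean` §4b). Nothing about any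
curve is asserted.

References: B. Mazur, J. Tate, J. Teitelbaum, Invent. Math. 84 (1986) §I.10, §I.13
[MazurTateTeitelbaum1986Invent]; K. Iwasawa, Lectures on `p`-adic `L`-functions (1972) §4.4
[Iwasawa1972PadicL]; R. L. Miller, LMS J. Comput. Math. 14 (2011) Def. 1.1 [Miller2011LMS];
J. H. Silverman, Advanced Topics (1994) V.5.3 [SilvermanATAEC1994]; registers
HOME/cells/n1011/PREDICTIONS-KURREG.md §3/§9, ROUTE-2.md §II.12 (EVIDENCE / planning documents).
-/

set_option autoImplicit false

noncomputable section

open scoped Classical MatrixGroups ModularForm NumberField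

open CongruenceSubgroup WeierstrassCurve NumberField Literature.NumberTheory.EllipticCurves
  Literature.NumberTheory.EllipticCurves.ModularForms
  Literature.NumberTheory.EllipticCurves.Rank1Residual
  Literature.NumberTheory.EllipticCurves.Rank1Residual.Typed
  Literature.NumberTheory.EllipticCurves.Delbourgo2002
  Literature.NumberTheory.GaloisRepresentations
  Summit.BirchSwinnertonDyer.Rank1Residual.AdditivePotMult
  IsDedekindDomain

namespace Summit.BirchSwinnertonDyer.Rank1Residual.Additive

namespace CensusX42

variable {p : ℕ} [hp : Fact p.Prime]

/-! ### §1 Bookkeeping: the valuation of the census identity when `v_p(ϖ·[T¹]B) = v` -/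

/-- **The valuation of the census identity (pure bookkeeping), linear coefficient of valuation `v`.**
If `x · ℓ · #T² = u · κ · (s · R · ∏c)` in `ℚ_p` with `x ≠ 0`, `v_p(x) = v` (`x = ϖ·[T¹]B`), `ℓ ≠ 0` of
valuation `1` (`ℓ = log_p γ_cyc`), `u, κ` of valuation `0` (`u = α♭⁻¹` or `ã⁻¹`, `κ ∈ {1, c_∞}`), and
`s = q·#T²/∏c` (`s = #Ш_an`, `L'(E,1) = q·Ω_E·Reg_∞`), `q ≠ 0`, then `R ≠ 0` and
`ord_p q + ord_p R = 1 + v` (`CensusX42BSD.lean` §1 is the case `v = 0`). [folklore] -/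
theorem padicValRat_add_valuation_eq_of_identity_of_valuation {W : WeierstrassCurve ℚ} [W.IsElliptic]
    {x ℓ u κ R : ℚ_[p]} {q : ℚ} {v : ℤ} (hq : q ≠ 0) (hx0 : x ≠ 0) (hxv : x.valuation = v)
    (hℓ0 : ℓ ≠ 0) (hℓ : ℓ.valuation = 1) (hu0 : u ≠ 0) (hu : u.valuation = 0) (hκ0 : κ ≠ 0)
    (hκ : κ.valuation = 0)
    (hid : x * ℓ * (W.torsionOrder : ℚ_[p]) ^ 2 =
      u * κ * (((q * (W.torsionOrder : ℚ) ^ 2 / W.tamagawaProduct : ℚ) : ℚ_[p]) * R *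
        (W.tamagawaProduct : ℚ_[p]))) :
    R ≠ 0 ∧ padicValRat p q + R.valuation = 1 + v := by
  have hTpos : 0 < W.torsionOrder := W.torsionOrder_pos_holds
  have hPpos : 0 < W.tamagawaProduct := W.tamagawaProduct_pos_holds
  have hT : (W.torsionOrder : ℚ_[p]) ≠ 0 := by exact_mod_cast hTpos.ne'
  have hP : (W.tamagawaProduct : ℚ_[p]) ≠ 0 := by exact_mod_cast hPpos.ne'
  have hTq : (W.torsionOrder : ℚ) ≠ 0 := by exact_mod_cast hTpos.ne'
  have hPq : (W.tamagawaProduct : ℚ) ≠ 0 := by exact_mod_cast hPpos.ne'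
  set s : ℚ := q * (W.torsionOrder : ℚ) ^ 2 / W.tamagawaProduct with hs_def
  have hs0 : s ≠ 0 := div_ne_zero (mul_ne_zero hq (pow_ne_zero 2 hTq)) hPq
  have hsp : ((s : ℚ) : ℚ_[p]) ≠ 0 := by exact_mod_cast hs0
  have hLHS : x * ℓ * (W.torsionOrder : ℚ_[p]) ^ 2 ≠ 0 :=
    mul_ne_zero (mul_ne_zero hx0 hℓ0) (pow_ne_zero 2 hT)
  have hRHS : u * κ * (((s : ℚ) : ℚ_[p]) * R * (W.tamagawaProduct : ℚ_[p])) ≠ 0 := by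
    rw [← hid]; exact hLHS
  have hR0 : R ≠ 0 := by
    intro hR
    apply hRHS
    rw [hR, mul_zero, zero_mul, mul_zero]
  refine ⟨hR0, ?_⟩
  have hval := congrArg Padic.valuation hid
  rw [Padic.valuation_mul (mul_ne_zero hx0 hℓ0) (pow_ne_zero 2 hT), Padic.valuation_mul hx0 hℓ0,
    Padic.valuation_pow, Padic.valuation_natCast,
    Padic.valuation_mul (mul_ne_zero hu0 hκ0) (mul_ne_zero (mul_ne_zero hsp hR0) hP),
    Padic.valuation_mul hu0 hκ0, Padic.valuation_mul (mul_ne_zero hsp hR0) hP,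
    Padic.valuation_mul hsp hR0, Padic.valuation_ratCast, Padic.valuation_natCast, hxv, hℓ, hu,
    hκ] at hval
  have hsval : padicValRat p s =
      padicValRat p q + 2 * padicValNat p W.torsionOrder - padicValNat p W.tamagawaProduct := by
    rw [hs_def, padicValRat.div (mul_ne_zero hq (pow_ne_zero 2 hTq)) hPq,
      padicValRat.mul hq (pow_ne_zero 2 hTq), padicValRat.pow, padicValRat.of_nat,
      padicValRat.of_nat]
    push_cast
    ring
  rw [hsval] at hval
  push_cast at hval
  linarith

/-! ### §2 Pointwise: a twist model whose linear coefficient has valuation `v₁` -/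

/-- **(G)-ordinary twist model, pointwise.** `W = E` globally minimal, additive at the odd prime `p`,
`r_an = 1`, `L'(E,1) = q·Ω_E·Reg_∞(E)` (`q ≠ 0`); `V` globally minimal ORDINARY at `p` with
`C • V^{(p*)} = W`, `f` a newform of `V`, `ϖ` the period ratio of the parity of `(p−1)/2`: if
`‖[T¹](ϖ·B^{±}_{(p−1)/2}(f, α_p(V)))‖_p = p^{−v₁}` and `CensusX42.RelationAt W p Dh` holds, then
`Reg_p(E,Dh) ≠ 0` and `ord_p q + ord_p Reg_p(E,Dh) = 1 + v₁` (`κ = 1` at `p ≡ 1`, `κ = c_∞(E)` at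
`p ≡ 3 (mod 4)`). [cite: MazurTateTeitelbaum1986Invent, §I.13] [cite: Iwasawa1972PadicL, §4.4] -/
theorem padicValRat_add_valuation_eq_of_relationAt_of_norm_coeff_one (hp2 : p ≠ 2)
    {W : WeierstrassCurve ℚ} [W.IsElliptic] [W.IsGloballyMinimal] (hadd : Addv W p)
    (hr : W.analyticRank = 1) {q : ℚ} (hq : q ≠ 0)
    (hLq : W.leadingLCoeff = (q : ℂ) * (W.realPeriodRat : ℂ) * (W.regulator : ℂ))
    (V : WeierstrassCurve ℚ) [V.IsElliptic] [V.IsGloballyMinimal] (C : VariableChange ℚ)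
    (hC : C • V.quadraticTwist ((-1 : ℚ) ^ (p / 2) * p) = W) (hord : IsOrdinaryAt V p)
    {N : ℕ} [NeZero N] {f : CuspForm (Gamma0 N) 2} (hf : IsNewformOf V f)
    (ϖ : ℚ) (hϖ : if Even (p / 2) then (ϖ : ℝ) * V.realPeriodRat = plusPeriod f
      else (ϖ : ℝ) * V.imaginaryPeriodRat = minusPeriod f)
    {v₁ : ℤ} (hv₁ : ‖PowerSeries.coeff 1 (PowerSeries.C (ϖ : ℚ_[p]) *
        (if Even (p / 2) then padicLFunctionBranch f ((unitRoot V p : ℤ_[p]) : ℚ_[p]) (p / 2)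
          else padicLFunctionMinusBranch f ((unitRoot V p : ℤ_[p]) : ℚ_[p]) (p / 2)))‖ =
        (p : ℝ) ^ (-v₁))
    {Dh : PAdicHeightData W p} (hrel : RelationAt W p Dh) :
    padicRegulator Dh ≠ 0 ∧ padicValRat p q + (padicRegulator Dh).valuation = 1 + v₁ := by
  have hs := shaAn_eq_of_leadingLCoeff_eq W hLq
  obtain ⟨heven, hodd⟩ := hrel V C f hadd (Or.inl hord.1) hf hr _ hs
  obtain ⟨hℓ0, hℓ⟩ := X2.valuation_padicLog_cyclotomicGenerator (p := p) hp2
  obtain ⟨hu0, hu⟩ := unitRoot_inv_ne_zero_and_valuation (p := p) V hord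
  have hodd4 : p % 4 = 1 ∨ p % 4 = 3 := by
    obtain ⟨k, hk⟩ := hp.out.odd_of_ne_two hp2
    omega
  rcases hodd4 with h1 | h3
  · -- `p ≡ 1 (mod 4)`: even branch, `κ = 1`
    have hev : Even (p / 2) := ⟨p / 4, by omega⟩
    have hC' : C • V.quadraticTwist (p : ℚ) = W := by
      rw [pStar_eq_of_mod_four p (Or.inl h1), if_pos h1] at hC; exact hC
    rw [if_pos hev] at hϖ hv₁
    rw [PowerSeries.coeff_C_mul] at hv₁
    obtain ⟨hx0, hxv⟩ := CensusQ6.norm_eq_zpow_neg_iff.mp hv₁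
    obtain ⟨-, -, hid⟩ := (heven h1 hC' ϖ hϖ).1 hord
    refine padicValRat_add_valuation_eq_of_identity_of_valuation (W := W) hq hx0 hxv hℓ0 hℓ hu0 hu
      one_ne_zero Padic.valuation_one ?_
    rw [mul_one]
    exact hid
  · -- `p ≡ 3 (mod 4)`: odd branch, `κ = c_∞(E)`
    have hnev : ¬ Even (p / 2) := by rw [Nat.not_even_iff_odd]; exact ⟨p / 4, by omega⟩
    have hC' : C • V.quadraticTwist (-(p : ℚ)) = W := by
      rw [pStar_eq_of_mod_four p (Or.inr h3), if_neg (by omega)] at hC; exact hC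
    rw [if_neg hnev] at hϖ hv₁
    rw [PowerSeries.coeff_C_mul] at hv₁
    obtain ⟨hx0, hxv⟩ := CensusQ6.norm_eq_zpow_neg_iff.mp hv₁
    obtain ⟨-, -, hid⟩ := (hodd h3 hC' ϖ hϖ).1 hord
    obtain ⟨hκ0, hκ⟩ := numRealComponents_cast_ne_zero_and_valuation (p := p) hp2 W
    exact padicValRat_add_valuation_eq_of_identity_of_valuation (W := W) hq hx0 hxv hℓ0 hℓ hu0 hu hκ0
      hκ hid

/-- **Multiplicative twist model, pointwise** (`V` MULTIPLICATIVE at `p`, `ã = a_p(V) = ±1`, the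
one-term branches `L_p^{±}`). [cite: MazurTateTeitelbaum1986Invent, §I.10, §I.13]
[cite: Iwasawa1972PadicL, §4.4] -/
theorem padicValRat_add_valuation_eq_of_relationAt_of_norm_coeff_one_mult (hp2 : p ≠ 2)
    {W : WeierstrassCurve ℚ} [W.IsElliptic] [W.IsGloballyMinimal] (hadd : Addv W p)
    (hr : W.analyticRank = 1) {q : ℚ} (hq : q ≠ 0)
    (hLq : W.leadingLCoeff = (q : ℂ) * (W.realPeriodRat : ℂ) * (W.regulator : ℂ))
    (V : WeierstrassCurve ℚ) [V.IsElliptic] [V.IsGloballyMinimal] (C : VariableChange ℚ)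
    (hC : C • V.quadraticTwist ((-1 : ℚ) ^ (p / 2) * p) = W) (hV : Mult V p)
    {N : ℕ} [NeZero N] {f : CuspForm (Gamma0 N) 2} (hf : IsNewformOf V f)
    (ϖ : ℚ) (hϖ : if Even (p / 2) then (ϖ : ℝ) * V.realPeriodRat = plusPeriod f
      else (ϖ : ℝ) * V.imaginaryPeriodRat = minusPeriod f)
    {v₁ : ℤ} (hv₁ : ‖PowerSeries.coeff 1 (PowerSeries.C (ϖ : ℚ_[p]) *
        (if Even (p / 2) then padicLFunctionPlusBranchMult f (((V.LFunction p : ℤ)) : ℚ_[p]) (p / 2)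
          else padicLFunctionMinusBranchMult f (((V.LFunction p : ℤ)) : ℚ_[p]) (p / 2)))‖ =
        (p : ℝ) ^ (-v₁))
    {Dh : PAdicHeightData W p} (hrel : RelationAt W p Dh) :
    padicRegulator Dh ≠ 0 ∧ padicValRat p q + (padicRegulator Dh).valuation = 1 + v₁ := by
  have hs := shaAn_eq_of_leadingLCoeff_eq W hLq
  obtain ⟨heven, hodd⟩ := hrel V C f hadd (Or.inr hV) hf hr _ hs
  obtain ⟨hℓ0, hℓ⟩ := X2.valuation_padicLog_cyclotomicGenerator (p := p) hp2
  obtain ⟨hu0, hu⟩ := intCast_LFunction_inv_ne_zero_and_valuation (p := p) hf hV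
  have hodd4 : p % 4 = 1 ∨ p % 4 = 3 := by
    obtain ⟨k, hk⟩ := hp.out.odd_of_ne_two hp2
    omega
  rcases hodd4 with h1 | h3
  · have hev : Even (p / 2) := ⟨p / 4, by omega⟩
    have hC' : C • V.quadraticTwist (p : ℚ) = W := by
      rw [pStar_eq_of_mod_four p (Or.inl h1), if_pos h1] at hC; exact hC
    rw [if_pos hev] at hϖ hv₁
    rw [PowerSeries.coeff_C_mul] at hv₁
    obtain ⟨hx0, hxv⟩ := CensusQ6.norm_eq_zpow_neg_iff.mp hv₁
    obtain ⟨-, -, hid⟩ := (heven h1 hC' ϖ hϖ).2 hV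
    refine padicValRat_add_valuation_eq_of_identity_of_valuation (W := W) hq hx0 hxv hℓ0 hℓ hu0 hu
      one_ne_zero Padic.valuation_one ?_
    rw [mul_one]
    exact hid
  · have hnev : ¬ Even (p / 2) := by rw [Nat.not_even_iff_odd]; exact ⟨p / 4, by omega⟩
    have hC' : C • V.quadraticTwist (-(p : ℚ)) = W := by
      rw [pStar_eq_of_mod_four p (Or.inr h3), if_neg (by omega)] at hC; exact hC
    rw [if_neg hnev] at hϖ hv₁
    rw [PowerSeries.coeff_C_mul] at hv₁
    obtain ⟨hx0, hxv⟩ := CensusQ6.norm_eq_zpow_neg_iff.mp hv₁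
    obtain ⟨-, -, hid⟩ := (hodd h3 hC' ϖ hϖ).2 hV
    obtain ⟨hκ0, hκ⟩ := numRealComponents_cast_ne_zero_and_valuation (p := p) hp2 W
    exact padicValRat_add_valuation_eq_of_identity_of_valuation (W := W) hq hx0 hxv hℓ0 hℓ hu0 hu hκ0
      hκ hid

/-! ### §3 From the census record `v₁` on the semistable-twist rows (twist model = kernel theorem) -/

/-- **(G-ord, `e = 2`) rows, `r_an = 1`: the record `CensusQ6.GordCoeffValAt W p 1 v₁` + the census
relation AT THE PAIR ⟹ `Reg_p(E,Dh) ≠ 0 ∧ ord_p q + ord_p Reg_p(E,Dh) = 1 + v₁`** (`E` additive at the odd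
prime `p`, `TypeGOrd`, `e_E(p) = 2`; the good-ordinary twist model, its newform and the period ratio
are kernel theorems — no class / image / CM / anomalous binder). EVIDENCE-conditional on both census
inputs. [cite: MazurTateTeitelbaum1986Invent, §I.13] [cite: Iwasawa1972PadicL, §4.4] -/
theorem padicValRat_add_valuation_eq_of_relationAt_of_gordCoeffValAt_one
    (hmodD : nonempty_modularParametrizationData) (hp2 : p ≠ 2)
    {W : WeierstrassCurve ℚ} [W.IsElliptic] [W.IsGloballyMinimal] (hG : TypeGOrd W p)
    (hadd : Addv W p) (he : semistabilityIndex W p = 2) (hr : W.analyticRank = 1) {q : ℚ} (hq : q ≠ 0)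
    (hLq : W.leadingLCoeff = (q : ℂ) * (W.realPeriodRat : ℂ) * (W.regulator : ℂ))
    {v₁ : ℤ} (hval : CensusQ6.GordCoeffValAt W p 1 v₁)
    {Dh : PAdicHeightData W p} (hrel : RelationAt W p Dh) :
    padicRegulator Dh ≠ 0 ∧ padicValRat p q + (padicRegulator Dh).valuation = 1 + v₁ := by
  obtain ⟨V, iV, iVm, C, hV, hC⟩ := TypeGOrd.exists_goodOrd_pStar_twist_model W p hp2 hG hadd he
  haveI : NeZero (V.conductorNorm ℤ) := ⟨(V.conductorNorm_pos_holds).ne'⟩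
  obtain ⟨Dm⟩ := hmodD V
  obtain ⟨ϖ, hϖ⟩ := exists_periodRatio_parity (p := p) V Dm
  have hord : IsOrdinaryAt V p := hV
  exact padicValRat_add_valuation_eq_of_relationAt_of_norm_coeff_one hp2 hadd hr hq hLq V C hC hord
    Dm.isNewformOf ϖ hϖ (hval V C hC hord Dm.f Dm.isNewformOf ϖ hϖ) hrel

/-- **(M) rows, `r_an = 1`: the record `CensusQ6.MultCoeffValAt W p 1 v₁` + the census relation AT THE
PAIR ⟹ `Reg_p(E,Dh) ≠ 0 ∧ ord_p q + ord_p Reg_p(E,Dh) = 1 + v₁`** (`AdditivePotMult.PotMult W p`: `E`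
additive, potentially multiplicative at the odd prime `p`; twist model by
`PotMult.exists_mult_pStar_twist_model`; no class / image binder). EVIDENCE-conditional. [cite: MazurTateTeitelbaum1986Invent, §I.10, §I.13] [cite: SilvermanATAEC1994, V.5.3] -/
theorem padicValRat_add_valuation_eq_of_relationAt_of_multCoeffValAt_one
    (hmodD : nonempty_modularParametrizationData) (hp2 : p ≠ 2)
    {W : WeierstrassCurve ℚ} [W.IsElliptic] [W.IsGloballyMinimal] (hpm : AdditivePotMult.PotMult W p)
    (hr : W.analyticRank = 1) {q : ℚ} (hq : q ≠ 0)
    (hLq : W.leadingLCoeff = (q : ℂ) * (W.realPeriodRat : ℂ) * (W.regulator : ℂ))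
    {v₁ : ℤ} (hval : CensusQ6.MultCoeffValAt W p 1 v₁)
    {Dh : PAdicHeightData W p} (hrel : RelationAt W p Dh) :
    padicRegulator Dh ≠ 0 ∧ padicValRat p q + (padicRegulator Dh).valuation = 1 + v₁ := by
  obtain ⟨V, iV, iVm, C, hV, hC⟩ := hpm.exists_mult_pStar_twist_model hp2
  haveI : NeZero (V.conductorNorm ℤ) := ⟨(V.conductorNorm_pos_holds).ne'⟩
  obtain ⟨Dm⟩ := hmodD V
  obtain ⟨ϖ, hϖ⟩ := exists_periodRatio_parity (p := p) V Dm
  exact padicValRat_add_valuation_eq_of_relationAt_of_norm_coeff_one_mult hp2 hpm.1 hr hq hLq V C hC hV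
    Dm.isNewformOf ϖ hϖ (hval V C hV hC Dm.f Dm.isNewformOf (V.LFunction p) (Dm.isNewformOf.2 p) ϖ hϖ)
    hrel

/-! ### §4 With `#Ш_an = s`: the informational column `vReg_x42(v₁)` -/

/-- `#Ш_an = s`, `r_an ≥ 1`-shape: `q := s·∏c/#T²` is the rational with `L^{(r)}(E,1)/r! = q·Ω_E·Reg_∞`,
`q ≠ 0` when `s ≠ 0`, and `ord_p q = ord_p s + ord_p ∏c − 2·ord_p #T`. [cite: Miller2011LMS, Def. 1.1] -/
theorem padicValRat_shaAn_ratio (W : WeierstrassCurve ℚ) [W.IsElliptic] {s : ℚ} (hs0 : s ≠ 0) :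
    s * W.tamagawaProduct / (W.torsionOrder : ℚ) ^ 2 ≠ 0 ∧
      padicValRat p (s * W.tamagawaProduct / (W.torsionOrder : ℚ) ^ 2) =
        padicValRat p s + padicValNat p W.tamagawaProduct - 2 * padicValNat p W.torsionOrder := by
  have hTq : (W.torsionOrder : ℚ) ≠ 0 := by exact_mod_cast (W.torsionOrder_pos_holds).ne'
  have hPq : (W.tamagawaProduct : ℚ) ≠ 0 := by
    exact_mod_cast (W.tamagawaProduct_pos_holds : 0 < W.tamagawaProduct).ne'
  refine ⟨div_ne_zero (mul_ne_zero hs0 hPq) (pow_ne_zero 2 hTq), ?_⟩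
  rw [padicValRat.div (mul_ne_zero hs0 hPq) (pow_ne_zero 2 hTq), padicValRat.mul hs0 hPq,
    padicValRat.pow, padicValRat.of_nat, padicValRat.of_nat]
  push_cast
  ring

/-- **`vReg_x42(v₁)` on the (G-ord, `e = 2`) rows.** With `#Ш_an = s` (`s ≠ 0`), the record
`CensusQ6.GordCoeffValAt W p 1 v₁` and the census relation at the pair:
`ord_p Reg_p(E,Dh) = 1 + v₁ + 2·ord_p #T − ord_p s − ord_p ∏c` — n1011-r2's DERIVED informational
column of PREDICTIONS-KURREG (EVIDENCE × EVIDENCE, never scored). [cite: MazurTateTeitelbaum1986Invent, §I.13]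
[cite: Miller2011LMS, Def. 1.1] -/
theorem valuation_padicRegulator_eq_of_relationAt_of_gordCoeffValAt_one_of_shaAn
    (hmodD : nonempty_modularParametrizationData) (hp2 : p ≠ 2)
    {W : WeierstrassCurve ℚ} [W.IsElliptic] [W.IsGloballyMinimal] (hG : TypeGOrd W p)
    (hadd : Addv W p) (he : semistabilityIndex W p = 2) (hr : W.analyticRank = 1)
    {s : ℚ} (hs : shaAn W = (s : ℂ)) (hs0 : s ≠ 0)
    {v₁ : ℤ} (hval : CensusQ6.GordCoeffValAt W p 1 v₁)
    {Dh : PAdicHeightData W p} (hrel : RelationAt W p Dh) :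
    padicRegulator Dh ≠ 0 ∧ (padicRegulator Dh).valuation =
      1 + v₁ + 2 * padicValNat p W.torsionOrder - padicValRat p s - padicValNat p W.tamagawaProduct := by
  obtain ⟨hq0, hqv⟩ := padicValRat_shaAn_ratio (p := p) W hs0
  obtain ⟨hR, hid⟩ := padicValRat_add_valuation_eq_of_relationAt_of_gordCoeffValAt_one hmodD hp2 hG
    hadd he hr hq0 (leadingLCoeff_eq_of_shaAn_eq W hs) hval hrel
  refine ⟨hR, ?_⟩
  rw [hqv] at hid
  linarith

/-- **`vReg_x42(v₁)` on the (M) rows** (same reading; `E` potentially multiplicative at `p`).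
[cite: MazurTateTeitelbaum1986Invent, §I.10, §I.13] [cite: Miller2011LMS, Def. 1.1] -/
theorem valuation_padicRegulator_eq_of_relationAt_of_multCoeffValAt_one_of_shaAn
    (hmodD : nonempty_modularParametrizationData) (hp2 : p ≠ 2)
    {W : WeierstrassCurve ℚ} [W.IsElliptic] [W.IsGloballyMinimal] (hpm : AdditivePotMult.PotMult W p)
    (hr : W.analyticRank = 1) {s : ℚ} (hs : shaAn W = (s : ℂ)) (hs0 : s ≠ 0)
    {v₁ : ℤ} (hval : CensusQ6.MultCoeffValAt W p 1 v₁)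
    {Dh : PAdicHeightData W p} (hrel : RelationAt W p Dh) :
    padicRegulator Dh ≠ 0 ∧ (padicRegulator Dh).valuation =
      1 + v₁ + 2 * padicValNat p W.torsionOrder - padicValRat p s - padicValNat p W.tamagawaProduct := by
  obtain ⟨hq0, hqv⟩ := padicValRat_shaAn_ratio (p := p) W hs0
  obtain ⟨hR, hid⟩ := padicValRat_add_valuation_eq_of_relationAt_of_multCoeffValAt_one hmodD hp2 hpm
    hr hq0 (leadingLCoeff_eq_of_shaAn_eq W hs) hval hrel
  refine ⟨hR, ?_⟩
  rw [hqv] at hid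
  linarith


end CensusX42

open CensusX42 CensusQ6

variable {p : ℕ} [hp : Fact p.Prime]

/-! ### §5 Three census inputs on a (G-ord) big-image row: Q6 record at `n₀` + budget + relation ⟹ `BSD(E,p)` -/

/-- **THREE-RECORD NODE, (G-ord), `p ≡ 1 (mod 4)`, non-anomalous, `ρ̄` onto, `r_an = 1`:** the Q6
record `CensusQ6.GordFirstUnitIndexAt W p n₀` (ANY `n₀`) + `BudgetLeLambdaAt p W n₀` + the census
relation for every (B)-datum + Kato half + Delbourgo 2002 + GZ + GZK + modularity ⟹ `BSD(E,p)`
(`CensusX42BSDIMC.lean` §4a fed by the interlock `CensusQ6.branchUnitCoeffAt_of_gordFirstUnitIndexAt`).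
EVIDENCE-conditional; nothing booked. [cite: Kato2004Asterisque, Thm. 17.4 (3) (p. 273)]
[cite: Delbourgo2002, Theorem (A), (B) (p. 40)] [cite: GrossZagier1986, Thm. I.(7.3)] [cite: Miller2011LMS, Def. 1.1] -/
theorem ClassX4Gord.bsdp_rankOne_of_katoHalf_of_gordFirstUnitIndexAt_of_budget_of_forall_censusX42
    {W : WeierstrassCurve ℚ} [W.IsElliptic] [W.IsGloballyMinimal] (hDel : Delbourgo2002.mainTheorem)
    (hK : Wuthrich2014.kato_halfEigenCharIdeal_dvd_cyclotomicPrime_of_surjective)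
    (hGZ : GrossZagier1986_thm_I_7_3) (hmod : hasEntireLFunction_rat)
    (hmodD : nonempty_modularParametrizationData) (hGZK : rank_eq_analyticRank_of_analyticRank_le_one)
    (hX : ClassX4Gord W p) (he : semistabilityIndex W p = 2) (hp4 : p % 4 = 1)
    (hna : ReductionNonAnomalous W p) (hsurj : Surj W p) (hr : W.analyticRank = 1)
    {n₀ : ℕ} (hrec : GordFirstUnitIndexAt W p n₀) (hbud : BudgetLeLambdaAt p W n₀)
    (hrel : ∀ Dh : PAdicHeightData W p, LeadingTermClauses W p Dh → RelationAt W p Dh) : BSDp W p :=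
  hX.bsdp_rankOne_of_katoHalf_of_coeffCert_of_budget_of_forall_censusX42 hDel hK hGZ hmod hmodD hGZK he hp4
    hna hsurj hr (branchUnitCoeffAt_of_gordFirstUnitIndexAt hp4 hrec) hbud hrel

/-- **THREE-RECORD NODE, (G-ord), `p ≡ 3 (mod 4)`, `p ≥ 5`** (odd record `CensusQ6.GordOddFirstUnitIndexAt
W p n₀`). [cite: Kato2004Asterisque, Thm. 17.4 (3) (p. 273)] [cite: Delbourgo2002, Theorem (A), (B) (p. 40)]
[cite: GrossZagier1986, Thm. I.(7.3)] [cite: Miller2011LMS, Def. 1.1] -/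
theorem ClassX4Gord.bsdp_rankOne_of_katoHalf_of_gordOddFirstUnitIndexAt_of_budget_of_forall_censusX42
    {W : WeierstrassCurve ℚ} [W.IsElliptic] [W.IsGloballyMinimal] (hDel : Delbourgo2002.mainTheorem)
    (hK : Wuthrich2014.kato_halfEigenCharIdeal_dvd_cyclotomicPrime_of_surjective)
    (hGZ : GrossZagier1986_thm_I_7_3) (hmod : hasEntireLFunction_rat)
    (hmodD : nonempty_modularParametrizationData) (hGZK : rank_eq_analyticRank_of_analyticRank_le_one)
    (hX : ClassX4Gord W p) (he : semistabilityIndex W p = 2) (hp4 : p % 4 = 3) (hp5 : 5 ≤ p)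
    (hna : ReductionNonAnomalous W p) (hsurj : Surj W p) (hr : W.analyticRank = 1)
    {n₀ : ℕ} (hrec : GordOddFirstUnitIndexAt W p n₀) (hbud : BudgetLeLambdaAt p W n₀)
    (hrel : ∀ Dh : PAdicHeightData W p, LeadingTermClauses W p Dh → RelationAt W p Dh) : BSDp W p :=
  hX.bsdp_rankOne_of_katoHalf_of_coeffCert_of_budget_of_forall_censusX42_odd hDel hK hGZ hmod hmodD hGZK he
    hp4 hp5 hna hsurj hr (branchUnitCoeffAt_of_gordOddFirstUnitIndexAt hp4 hrec) hbud hrel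

/-- **THREE-RECORD NODE at `p = 3`, (G-ord), non-CM, non-anomalous, `ρ̄_{E,3}` onto, `r_an = 1`** (odd
record at `3`; `hDel3`). [cite: Kato2004Asterisque, Thm. 17.4 (3) (p. 273)]
[cite: Delbourgo2002, Theorem (A), (B), Example (p. 40)] [cite: GrossZagier1986, Thm. I.(7.3)]
[cite: Miller2011LMS, Def. 1.1] -/
theorem ClassX4Gord.bsdp_three_rankOne_of_katoHalf_of_gordOddFirstUnitIndexAt_of_budget_of_forall_censusX42
    [Fact (Nat.Prime 3)] {W : WeierstrassCurve ℚ} [W.IsElliptic] [W.IsGloballyMinimal]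
    (hDel3 : Delbourgo2002.mainTheorem_three)
    (hK : Wuthrich2014.kato_halfEigenCharIdeal_dvd_cyclotomicPrime_of_surjective)
    (hGZ : GrossZagier1986_thm_I_7_3) (hmod : hasEntireLFunction_rat)
    (hmodD : nonempty_modularParametrizationData) (hGZK : rank_eq_analyticRank_of_analyticRank_le_one)
    (hX : ClassX4Gord W 3) (hcm : ¬ W.HasCM) (hna : ReductionNonAnomalous W 3) (hsurj : Surj W 3)
    (hr : W.analyticRank = 1) {n₀ : ℕ} (hrec : GordOddFirstUnitIndexAt W 3 n₀)
    (hbud : BudgetLeLambdaAt 3 W n₀)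
    (hrel : ∀ Dh : PAdicHeightData W 3, LeadingTermClauses W 3 Dh → RelationAt W 3 Dh) : BSDp W 3 :=
  hX.bsdp_three_rankOne_of_katoHalf_of_coeffCert_of_budget_of_forall_censusX42 hDel3 hK hGZ hmod hmodD hGZK
    hcm hna hsurj hr (branchUnitCoeffAt_of_gordOddFirstUnitIndexAt (by decide) hrec) hbud hrel

end Summit.BirchSwinnertonDyer.Rank1Residual.Additive

end
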